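import Literature.AlgebraicGeometry.Frobenioids.ArithmeticFrobenioidThm64iiAtData
import HarnessLib

/-!
# Frobenioids I, Theorem 6.4 (ii) AT THE DATA — functor form of the binders (`Ψ^Base` a functor that IS an
# equivalence, as [FrdI] Cor. 4.11 delivers it)

Mochizuki, *The geometry of Frobenioids I: the general theory*, Kyushu J. Math. **62** (2008) 293–400, §6,
Theorem 6.4 (ii), kurims text p. 114 [cite: MochizukiFrdI2008, Thm. 6.4 (ii) p.114]: "there exists an element
`deg(Ψ^rlf) ∈ ℝ_{>0}` such that … the composite of `δ_{A₂}` with the isomorphism `Pic_Φ(A₁) ⥲ Pic_Φ(A₂)` induced by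
`Ψ^rlf` … is equal to `deg(Ψ^rlf) · δ_{A₁}`"; proof p. 115 l. 34 – p. 116 l. 3 ("[cf. … Corollary 4.11, (iii)]").

PROOF-ONLY file (cell abc-iut, sub-DAG `plan/L1/SUBDAG-FrdI-Thm64.md` row T64ii AT THE DATA, L1-lead R114 (2); seat
abc-iut-w4-d086; no definitions).  abc-iut-w4-d086's `ArithFrd.exists_picMap_thm64ii` (`ArithmeticFrobenioidThm64iiAtData.lean`)
takes `Ψ^Base` as an `Equivalence`; [FrdI] Cor. 4.11 (ii)–(iv) (`PreFrobenioidData.OneUniqueSquare`, abc-iut-L1-t14's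
`Cor411OfFunctor`, abc-iut-L1-d7's `exists_rlfTransport_of_cor411iv`, abc-iut-L6-t10's `arith_rlf_exists_transportData`)
deliver it as a FUNCTOR with `Functor.IsEquivalence`.  This file restates the result in that form
(`ArithFrd.exists_picMap_thm64ii_functor`, via `Functor.asEquivalence`, whose underlying functor is `Ψ^Base`
definitionally), so that the (iii)/(iv) assemblies bind it BY NAME without plumbing.
Nothing here is specific to the abc programme or bears on [IUTchIII] Cor. 3.12; no statement of the paper is strengthened.
-/

noncomputable section

open scoped NNReal

namespace Literature.AlgebraicGeometry.Frobenioids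

open CategoryTheory Opposite

namespace ArithFrd

section FunctorForm

variable {F₁ : Type} [Field F₁] [NumberField F₁] {K₁ : Type} [Field K₁] [Algebra F₁ K₁]
  {F₂ : Type} [Field F₂] [NumberField F₂] {K₂ : Type} [Field K₂] [Algebra F₂ K₂]
  (hΦ₁ : PreFrobenioid.IsPerfFactorialOn (arithDivisorFunctor F₁ K₁))
  (hΦ₂ : PreFrobenioid.IsPerfFactorialOn (arithDivisorFunctor F₂ K₂))
  (Ψ : PreFrobenioid.rlf (ModelFrobenioid.toElem (arithDivisorFunctor F₁ K₁) (unitsFunctor F₁ K₁) (divNatTrans F₁ K₁)) hΦ₁ ≌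
    PreFrobenioid.rlf (ModelFrobenioid.toElem (arithDivisorFunctor F₂ K₂) (unitsFunctor F₂ K₂) (divNatTrans F₂ K₂)) hΦ₂)
  (ΨBase : FinSubextCat F₁ K₁ ⥤ FinSubextCat F₂ K₂) [ΨBase.IsEquivalence]
  (η : Ψ.functor ⋙ (FrdI.Cor54Sub.rlfData (ModelFrobenioid.toElem (arithDivisorFunctor F₂ K₂) (unitsFunctor F₂ K₂)
      (divNatTrans F₂ K₂)) hΦ₂).base ≅
    (FrdI.Cor54Sub.rlfData (ModelFrobenioid.toElem (arithDivisorFunctor F₁ K₁) (unitsFunctor F₁ K₁)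
      (divNatTrans F₁ K₁)) hΦ₁).base ⋙ ΨBase)
  (E : PreFrobenioidData.DivisorMonoidIsoOverBase
    (FrdI.Cor54Sub.rlfData (ModelFrobenioid.toElem (arithDivisorFunctor F₁ K₁) (unitsFunctor F₁ K₁)
      (divNatTrans F₁ K₁)) hΦ₁)
    (FrdI.Cor54Sub.rlfData (ModelFrobenioid.toElem (arithDivisorFunctor F₂ K₂) (unitsFunctor F₂ K₂)
      (divNatTrans F₂ K₂)) hΦ₂) ΨBase)
  (hspan : ∀ X : FinSubextCat F₁ K₁,
    (((RealificationData.canonical (arithDivisorFunctor F₁ K₁) (PreFrobenioid.IsPerfFactorialOn.op hΦ₁)).realSpan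
          (PreFrobenioid.biratSubfunctor (ModelFrobenioid.toElem (arithDivisorFunctor F₁ K₁) (unitsFunctor F₁ K₁)
            (divNatTrans F₁ K₁)))).carrier X).map (MonGp.map (E.iso X).toMonoidHom) =
      ((RealificationData.canonical (arithDivisorFunctor F₂ K₂) (PreFrobenioid.IsPerfFactorialOn.op hΦ₂)).realSpan
          (PreFrobenioid.biratSubfunctor (ModelFrobenioid.toElem (arithDivisorFunctor F₂ K₂) (unitsFunctor F₂ K₂)
            (divNatTrans F₂ K₂)))).carrier (ΨBase.obj X))

include η hspan in
/-- **Thm. 6.4 (ii) at THE data, functor form of the binders** — `Ψ^Base` a functor which IS an equivalence (the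
shape `OneUniqueSquare.1` in which [FrdI] Cor. 4.11 (ii)–(iv) delivers it), `Ψ^Φ` over it carrying the real spans: THE
induced `picMap` satisfies `Thm64ii`, with its values and degrees on classes of monoid elements
(`ArithFrd.exists_picMap_thm64ii` at `ΨBase.asEquivalence`). [cite: MochizukiFrdI2008, Thm. 6.4 (ii) p.114] -/
theorem exists_picMap_thm64ii_functor [IsGalois F₁ K₁] [IsGalois F₂ K₂] :
    ∃ picMap : ∀ A, (arithRealification hΦ₁).Pic A ≃+ (arithRealification hΦ₂).Pic (Ψ.functor.obj A),
      Thm64ii (arithRealification hΦ₁) (arithRealification hΦ₂) Ψ picMap ∧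
      (∀ (A : PreFrobenioid.rlf (ModelFrobenioid.toElem (arithDivisorFunctor F₁ K₁) (unitsFunctor F₁ K₁)
          (divNatTrans F₁ K₁)) hΦ₁)
          (x : (RealificationData.canonical (arithDivisorFunctor F₁ K₁) (PreFrobenioid.IsPerfFactorialOn.op hΦ₁)).rlf.obj
            (op A.base)),
          picMap A (Additive.ofMul (QuotientGroup.mk' _ (Algebra.GrothendieckGroup.of x))) =
            Additive.ofMul (((RealificationData.canonical (arithDivisorFunctor F₂ K₂)
              (PreFrobenioid.IsPerfFactorialOn.op hΦ₂)).realSpan (PreFrobenioid.biratSubfunctor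
                (ModelFrobenioid.toElem (arithDivisorFunctor F₂ K₂) (unitsFunctor F₂ K₂) (divNatTrans F₂ K₂)))).picPull
              (X := (Ψ.functor.obj A).base) (Y := ΨBase.obj A.base) (η.hom.app A)
              (QuotientGroup.mk' _ (Algebra.GrothendieckGroup.of (E.iso A.base x))))) ∧
      ∀ (A : PreFrobenioid.rlf (ModelFrobenioid.toElem (arithDivisorFunctor F₁ K₁) (unitsFunctor F₁ K₁)
          (divNatTrans F₁ K₁)) hΦ₁) (hA' : (arithRealification hΦ₂).ops.IsFrobeniusTrivial (Ψ.functor.obj A))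
          (x : (RealificationData.canonical (arithDivisorFunctor F₁ K₁) (PreFrobenioid.IsPerfFactorialOn.op hΦ₁)).rlf.obj
            (op A.base)),
        (arithRealification hΦ₂).δ (Ψ.functor.obj A) hA'
            (picMap A (Additive.ofMul (QuotientGroup.mk' _ (Algebra.GrothendieckGroup.of x)))) =
          Multiplicative.toAdd (ArithRlfPic.picDegree hΦ₂ (ΨBase.obj A.base)
            (QuotientGroup.mk' _ (Algebra.GrothendieckGroup.of (E.iso A.base x)))) :=
  exists_picMap_thm64ii hΦ₁ hΦ₂ Ψ ΨBase.asEquivalence η E hspan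

end FunctorForm


end ArithFrd

end Literature.AlgebraicGeometry.Frobenioids

end
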